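import Summits.AtomisticToContinuum.HydrodynamicLimit.Theorems.InformationPercolationEnginePercolationClosesChaosDockingReplace
import Summits.AtomisticToContinuum.HydrodynamicLimit.Theorems.InformationPercolationEnginePercolationClosesChaosDockingTiling
import HarnessLib

/-!
# Docking S7 of the line `equilibrium-forecast-chain-rule` (crux `InformationPercolationEngine.PercolationClosesChaos`,
stmt-AtomisticToContinuum-15178) — piece F2a: the tail of the target's defect and the unit-average dictionary in cell units

Support file (`--supports stmt-AtomisticToContinuum-15178`) of the registered stub
`stub_docking : KineticCellChaosLG → NoMesoscopicOscillation → LocalCountUI → ContactChaos` (worker S7 of lead c3).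
On a good orbit the target's defect is `ε/(N+1) ·` a sum of `dockSummand` over the collision triples of the steps `k < K_N`
and of the tail `(K_N Δ, τ]` (`dockDefect_eq_sum`, piece E). Small pieces of the deterministic bound (piece F2b):

* `stepLen_mul_sum_range_le_unitAvg`: the unit-average dictionary in cell units,
  `Δ h³ Σ_{k<M} Σ_{q ∈ box} F ≤ τ' · unitAvg_{τ'} F` for `M ≤ K_{τ'}` (`pairWeight_mul_sum_range_le_unitAvg` divided by
  `π σ³` through `ε/(N+1) · (n̄c) = π σ³ Δ h³`);
* `collTriples_tail_subset`, `abs_sum_dockSummand_tail_le` (registered helper F2a): the tail triples are triples of step `K_N`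
  (`τ < (K_N+1)Δ`), each summand bounded by `Cχ (CΨ S₁ + S_Ψ)` (`abs_dockSummand_le`), and
  `#triples of step K_N = (n̄c) Σ_q rowCount K_N q`, so `|Σ_tail dockSummand| ≤ Cχ (CΨ S₁ + S_Ψ) (n̄c) Σ_q rowCount K_N q`;
* `mul_mul_sum`: moving a scalar inside a finite sum.

Bookkeeping on the good set (CIP 1994 §4.2; GST 2013 Prop. 4.1.1).
-/

noncomputable section

open MeasureTheory Set Filter Topology
open scoped ENNReal BigOperators Classical
open Literature.Analysis.FluidPDE Literature.MathematicalPhysics.KineticTheory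
open Literature.MathematicalPhysics.KineticTheory.VelocityBlindPlacement

namespace Summit.AtomisticToContinuum.HydrodynamicLimit.Theorems.EquilibriumForecastLine


/-! ## The unit-average dictionary without the pair weight -/

/-- **Partial step sums against unit averages, in cell units**: for a nonnegative box-supported family and `M ≤ K_{τ'}`
steps, `Δ · h³ · Σ_{k<M} Σ_{q ∈ box} F k q ≤ τ' · unitAvg_{τ'} F` (`pairWeight_mul_sum_range_le_unitAvg` divided by `π σ³`
through `ε/(N+1) · (n̄c) = π σ³ Δ h³`). [folklore] -/
theorem stepLen_mul_sum_range_le_unitAvg {σ : ℝ} {N : ℕ} {c τ' : ℝ} {F : ℕ → Cell → ℝ} (hc : 0 < c) (hσ : 0 < σ)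
    (hτ' : 0 ≤ τ') {M : ℕ} (hM : M ≤ numSteps c σ N τ') (hF : ∀ k, ∀ q ∉ cellBox (c * meanFreePath σ N), F k q = 0)
    (hF0 : ∀ k q, 0 ≤ F k q) :
    stepLen c σ N * (c * meanFreePath σ N) ^ 3 *
        ∑ k ∈ Finset.range M, ∑ q ∈ cellBox (c * meanFreePath σ N), F k q ≤ τ' * unitAvg c σ N τ' F := by
  have h := pairWeight_mul_sum_range_le_unitAvg (N := N) hc hσ hτ' hM hF hF0
  rw [pairWeight_mul_cellCount'] at h
  have hP : 0 < Real.pi * σ ^ 3 := by positivity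
  refine le_of_mul_le_mul_left ?_ hP
  calc Real.pi * σ ^ 3 * (stepLen c σ N * (c * meanFreePath σ N) ^ 3 *
        ∑ k ∈ Finset.range M, ∑ q ∈ cellBox (c * meanFreePath σ N), F k q)
      = Real.pi * σ ^ 3 * stepLen c σ N * (c * meanFreePath σ N) ^ 3 *
        ∑ k ∈ Finset.range M, ∑ q ∈ cellBox (c * meanFreePath σ N), F k q := by ring
    _ ≤ Real.pi * σ ^ 3 * τ' * unitAvg c σ N τ' F := h
    _ = _ := by ring

/-! ## The tail and one step of the target's defect -/

section Pieces

variable {σ : ℝ} {N : ℕ} (Φ : Flow σ N) {z : Phase N}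

/-- The tail triples (times in `(KΔ, τ]`, `τ ≤ (K+1)Δ`) are triples of step `K`. [folklore] -/
theorem collTriples_tail_subset (hz : z ∈ Φ.good) {c τ : ℝ} {K : ℕ} (hτ : τ ≤ ((K : ℝ) + 1) * stepLen c σ N) :
    collTriples Φ (Ioc ((K : ℝ) * stepLen c σ N) τ) z ⊆ collTriples Φ (stepWindow c σ N K) z := by
  intro e he
  rw [mem_collTriples Φ hz (Ioc_subset_Icc_self (a := (K : ℝ) * stepLen c σ N) (b := τ))] at he
  rw [mem_collTriples Φ hz (stepWindow_subset_Icc c σ N K)]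
  exact ⟨⟨he.1.1, he.1.2.trans hτ⟩, he.2⟩

end Pieces

/-- **Registered helper `abs_sum_dockSummand_tail_le` (piece F2a of the docking S7): the tail of the defect**: the summands with times in `(K_N Δ, τ]` total at most
`Cχ (CΨ S₁ + S_Ψ) · (n̄c) Σ_{q ∈ box} rowCount K_N q` (they are triples of step `K_N`, each bounded by `abs_dockSummand_le`).
[folklore] -/
theorem abs_sum_dockSummand_tail_le : ∀ {σ : ℝ} {N : ℕ} (Φ : Flow σ N) {z : Phase N}, z ∈ Φ.good → ∀ {c : ℝ}, 0 < c → 0 < σ → ∀ (χ : ℝ × T3 → ℝ) (Ψ : V3 × V3 × V3 → ℝ) (r : ℝ) {τ S Cχ CΨ S₁ SΨ : ℝ}, ((numSteps c σ N τ : ℝ) + 1) * stepLen c σ N ≤ S → (∀ p : ℝ × T3, p.1 ∈ Icc 0 S → |χ p| ≤ Cχ) → (∀ p, |Ψ p| ≤ CΨ) → (∀ s x, |targetPm (fun _ => 1) r τ σ N Φ z s x| ≤ S₁) → (∀ s x, |targetPm Ψ r τ σ N Φ z s x| ≤ SΨ) → |∑ e ∈ collTriples Φ (Ioc ((numSteps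 c σ N τ : ℝ) * stepLen c σ N) τ) z, dockSummand χ Ψ r τ σ N Φ z e.1 (Φ.flow e.1 z) e.2.1 e.2.2| ≤ Cχ * (CΨ * S₁ + SΨ) * ((cellCount c σ N * c) * ∑ q ∈ cellBox (c * meanFreePath σ N), rowCount c σ N Φ (numSteps c σ N τ) q z) := by
  intro σ N Φ z hz c hc hσ χ Ψ r τ S Cχ CΨ S₁ SΨ hKS hχ hΨ hS1 hSΨ
  set K := numSteps c σ N τ with hK
  have hΔ : 0 < stepLen c σ N := stepLen_pos hc hσ N
  have hsub := collTriples_tail_subset Φ hz (lt_numSteps_succ_mul_stepLen hc hσ τ N).le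
  have hS0 : (0 : ℝ) ≤ S := le_trans (by positivity) hKS
  have hCχ : 0 ≤ Cχ := (abs_nonneg _).trans (hχ (0, cellCentre c σ N 0) ⟨le_rfl, hS0⟩)
  have hCΨ : 0 ≤ CΨ := (abs_nonneg _).trans (hΨ 0)
  have hS1' : 0 ≤ S₁ := (abs_nonneg _).trans (hS1 0 (cellCentre c σ N 0))
  have hSΨ' : 0 ≤ SΨ := (abs_nonneg _).trans (hSΨ 0 (cellCentre c σ N 0))
  have hCP : 0 ≤ Cχ * (CΨ * S₁ + SΨ) := by positivity
  calc |∑ e ∈ collTriples Φ (Ioc ((K : ℝ) * stepLen c σ N) τ) z, dockSummand χ Ψ r τ σ N Φ z e.1 (Φ.flow e.1 z) e.2.1 e.2.2|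
      ≤ ∑ e ∈ collTriples Φ (Ioc ((K : ℝ) * stepLen c σ N) τ) z,
          |dockSummand χ Ψ r τ σ N Φ z e.1 (Φ.flow e.1 z) e.2.1 e.2.2| := Finset.abs_sum_le_sum_abs _ _
    _ ≤ ∑ _e ∈ collTriples Φ (Ioc ((K : ℝ) * stepLen c σ N) τ) z, Cχ * (CΨ * S₁ + SΨ) :=
        Finset.sum_le_sum fun e he => abs_dockSummand_le Φ hz hc hσ χ Ψ r τ (hsub he) hKS hχ hΨ hS1 hSΨ
    _ = Cχ * (CΨ * S₁ + SΨ) * ((collTriples Φ (Ioc ((K : ℝ) * stepLen c σ N) τ) z).card : ℝ) := by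
        rw [Finset.sum_const, nsmul_eq_mul, mul_comm]
    _ ≤ Cχ * (CΨ * S₁ + SΨ) * ((collTriples Φ (stepWindow c σ N K) z).card : ℝ) :=
        mul_le_mul_of_nonneg_left (by exact_mod_cast Finset.card_le_card hsub) hCP
    _ = _ := by rw [card_collTriples_stepWindow_eq Φ hz hc hσ K]

/-! ## An elementary rewriting used by the deterministic bound -/

/-- `a · b · Σ f = a · Σ (b · f)` (to move a scalar inside a finite sum without touching the rest of the goal). [folklore] -/
theorem mul_mul_sum (a b : ℝ) (s : Finset ℕ) (f : ℕ → ℝ) : a * b * ∑ k ∈ s, f k = a * ∑ k ∈ s, b * f k := by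
  rw [mul_assoc, Finset.mul_sum]

end Summit.AtomisticToContinuum.HydrodynamicLimit.Theorems.EquilibriumForecastLine

end
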